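import Summits.KontsevichZagierPeriods.Zeta5Search.LaiSweepShard

/-!
# `κ₃` sweep certificate — shard file 122 of 127 (shards 854–860 of 889)

HONEST FRAMING. Systematic search; no irrationality claim unless certified. This file only checks,
by `decide +kernel`, shards 854–860 of the order-cell sweep of the `κ₃` point `(74, 2180, 444; δ74)`
(engine `LaiSweepEngine`, soundness `LaiSweepJump/Free/Eval/Shard/Kappa3`; a shard is `⟨regime, n,
p, q, p', q', Lo, Up⟩`: `n` cells from `p/q` to `p'/q'` with integer rate sums in `[Lo, Up]`, `K =
128`, `D = 2^40`). It draws NO conclusion: only the capstone `LaiKappa3SweepCert`, which needs all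
127 shard files, does. Kernel cost of this file ≈ 560 cells × 0.3 s.
-/

namespace Summit.KontsevichZagierPeriods.Zeta5Search.Sweep

set_option maxHeartbeats 100000000 in
/-- Shard 854: 80 cells of regime B from `329/344` to `317/331`.
[cite: Lai2024BallRivoal, §4 Lemma 4.3] -/
theorem shard854 :
    Shard.check 128 (2^40)
      ⟨true, 80, 329, 344, 317, 331, 10559176502465, 18690182056216⟩ = true := by
  decide +kernel

set_option maxHeartbeats 100000000 in
/-- Shard 855: 80 cells of regime B from `317/331` to `187/195`.
[cite: Lai2024BallRivoal, §4 Lemma 4.3] -/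
theorem shard855 :
    Shard.check 128 (2^40)
      ⟨true, 80, 317, 331, 187, 195, 10246545923980, 18155799554410⟩ = true := by
  decide +kernel

set_option maxHeartbeats 100000000 in
/-- Shard 856: 80 cells of regime B from `187/195` to `314/327`.
[cite: Lai2024BallRivoal, §4 Lemma 4.3] -/
theorem shard856 :
    Shard.check 128 (2^40)
      ⟨true, 80, 187, 195, 314, 327, 10236835446443, 18157307881928⟩ = true := by
  decide +kernel

set_option maxHeartbeats 100000000 in
/-- Shard 857: 80 cells of regime B from `314/327` to `299/311`.
[cite: Lai2024BallRivoal, §4 Lemma 4.3] -/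
theorem shard857 :
    Shard.check 128 (2^40)
      ⟨true, 80, 314, 327, 299, 311, 9424210495950, 16732454862024⟩ = true := by
  decide +kernel

set_option maxHeartbeats 100000000 in
/-- Shard 858: 80 cells of regime B from `299/311` to `4625/4804`.
[cite: Lai2024BallRivoal, §4 Lemma 4.3] -/
theorem shard858 :
    Shard.check 128 (2^40)
      ⟨true, 80, 299, 311, 4625, 4804, 10660320651165, 18946345072354⟩ = true := by
  decide +kernel

set_option maxHeartbeats 100000000 in
/-- Shard 859: 80 cells of regime B from `4625/4804` to `375/389`.
[cite: Lai2024BallRivoal, §4 Lemma 4.3] -/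
theorem shard859 :
    Shard.check 128 (2^40)
      ⟨true, 80, 4625, 4804, 375, 389, 10221288977150, 18185186646683⟩ = true := by
  decide +kernel

set_option maxHeartbeats 100000000 in
/-- Shard 860: 80 cells of regime B from `375/389` to `306/317`.
[cite: Lai2024BallRivoal, §4 Lemma 4.3] -/
theorem shard860 :
    Shard.check 128 (2^40)
      ⟨true, 80, 375, 389, 306, 317, 10361552634964, 18453880453298⟩ = true := by
  decide +kernel

/-- The checked shards of this file, in order. [folklore] -/
def shards122 : List (CheckedShard 128 (2^40)) :=
  [⟨_, shard854⟩, ⟨_, shard855⟩, ⟨_, shard856⟩, ⟨_, shard857⟩, ⟨_, shard858⟩,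
    ⟨_, shard859⟩, ⟨_, shard860⟩]

end Summit.KontsevichZagierPeriods.Zeta5Search.Sweep
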